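import Literature.MathematicalPhysics.QuantumFieldTheory.Balaban1983to89.TorusGeometry
import Literature.MathematicalPhysics.QuantumFieldTheory.Balaban1983to89.B12RTGaugeInvariance254

/-!
# `Balaban1983to89.BlockAxialRepresentative` — [Balaban1987RG1] p. 265 (2.2)–(2.3): the BLOCK-AXIAL REPRESENTATIVE «the element of the orbit
# satisfying the axial gauge conditions G(V) = 0», as an EXPLICIT gauge image, with its three bookkeeping properties (block contours trivial ∕
# `G = 0`; independence of the representative within the residual freedom; block-lift covariance)

CITATION HEADER.  T. Bałaban, *Renormalization group approach to lattice gauge field theories. I*, Commun. Math. Phys. **109** (1987) 249–301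
[Balaban1987RG1] (held `paper:balaban1987-cmp109-rg-i-small-field`, journal page = PDF page + 248; p. 265–266 re-read by this seat), p. 265 verbatim:
*"At first we look for critical points of the function V → G(V) + A(U_k(V)), V : V̄ = W. (2.2) Under the above regularity assumptions there exists
the exactly one critical point, which is obtained by taking the critical orbit of the function A(U_k(V)) considered on the subspace, and choosing the
element of the orbit satisfying the axial gauge conditions G(V) = 0. This critical configuration … is denoted by V^{(k)} = V^{(k)}(W) … (2.3)"*;
p. 266 (2.5): *"The gauge fixing term under the exponential in (2.1) is equal to G(VV^{(k)}) = G(V′)"*.  The block axial gauge itself is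
[Balaban1984PropagatorsI] (1.10) p. 19 (tree: `Setup.AxialGauge`), the gauge-fixing function `G(Y, U) = Σ_{y∈Y} Σ_{x∈B(y), x≠y} [1 − Re tr U(y,x)]` is
[Balaban1987RG1] (0.17) p. 255 (tree: `Setup.gaugeFixFn`).

WHAT IS TYPED (generic over the tree's contour datum `Setup.ContourData P j G` — the averaged contour variables `U(y, x)` of (0.11) with their gauge
covariance — and any `GaugeGroup G`; standing range `j + 1 ≤ m + K` where the block geometry needs it):
* `axializer cd V` — the gauge transformation `x ↦ 1` at the block centres `x = emb (blockOf x)`, `x ↦ U(blockOf x, x)` elsewhere; `axialize cd V := V^{axializer cd V}`.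
* `holTo_axialize` ∕ `axialGauge_axialize` ∕ `gaugeFixFn_axialize` — every block contour of the axialised configuration is `1`, i.e. it satisfies
  `Setup.AxialGauge cd` and print's normalisation `G(Y, ·) = 0` for every block family `Y` (whence (2.5)).
* `axialize_gaugeAct_of_central` — the axialised image does not see a gauge transformation `w` that is `1` at the block centres («central»): the
  representative depends only on the class of `V` modulo this residual freedom (the freedom two minimisers of (0.21) over one coarse field leave after
  averaging); `axialize_eq_self_of_axialGauge`, `eq_axialize_of_axialGauge_of_central` — it is the UNIQUE block-axial element of that class.
* `axialize_gaugeAct_liftTransf` — covariance under the block-constant lifts `v ∘ blockOf` of coarse gauge transformations ([I] (2.16) p. 269 bookkeeping).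

WHY (cell `ym-nodeO-ideate` ∕ `ym-balaban-port`, porter seat `ymgap-nodeO-port-PTA-2`, located reading «CHOICE CHANNEL» on `stmt-QuantumFields-27930`):
the NODE-00 record's critical configuration `Node00.critCfgOfRecord = Ū^k(Uk …)` is the k-fold average of a `Classical.choose`-minimiser with NO gauge
normalisation, so the (2.9) cut-off of record is centred at an arbitrary element of the residual class while the absolute gauge fixing `Node00.gfOfRecord`
is centred at the block-axial one; composing with `axialize` is the explicit, choice-free cure.  This file is GENERIC bookkeeping; it re-points nothing of
record (the type owner's call).

HONEST FRAMING.  Finite gauge algebra (`group`) and the tree's block geometry (`TorusGeometry.Site.blockOf_emb`); nothing of Bałaban's estimates is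
asserted; no `sorry`, no `instance`, no `notation`; standard axioms; the Yang–Mills mass gap is NOT proved by any of this.
-/

namespace Literature.MathematicalPhysics.QuantumFieldTheory.Balaban1983to89.BlockAxialRepresentative

open GaugeField (gaugeAct)
open B12RTGaugeInvariance254 (liftTransf)

variable {P : Params} {j : ℕ} {G : Type*} [GaugeGroup G]

/-! ## §1. The block-axialiser and the block-axial representative -/

/-- **The block-axialiser** of a configuration `V` on `T^{(j)}` for the contour datum `cd`: the gauge transformation equal to `1` at the block
centres and to the block contour `U(blockOf x, x)` at every other site — the transformation that carries `V` into the block axial gauge.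
[cite: Balaban1987RG1, p.265 (2.2)–(2.3) («the element of the orbit satisfying the axial gauge conditions G(V) = 0»)] -/
noncomputable def axializer (cd : ContourData P j G) (V : GaugeField P j G) : GaugeTransf P j G :=
  fun x => if x = emb (blockOf x) then 1 else cd.holTo V (blockOf x) x

/-- **The block-axial representative** `V^{axializer V}` — print's `V^{(k)}` normalisation of (2.3) applied to an arbitrary element of the residual class.
[cite: Balaban1987RG1, p.265 (2.2)–(2.3)] -/
noncomputable def axialize (cd : ContourData P j G) (V : GaugeField P j G) : GaugeField P j G :=
  gaugeAct (axializer cd V) V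

/-- Unfolding (definitional). [cite: Balaban1987RG1, p.265 (2.3) (bookkeeping)] -/
theorem axialize_def (cd : ContourData P j G) (V : GaugeField P j G) : axialize cd V = gaugeAct (axializer cd V) V := rfl

/-- At a block centre the axialiser is `1` (standing range). [cite: Balaban1987RG1, p.265 (2.3) (bookkeeping)] -/
theorem axializer_emb (hj : j + 1 ≤ P.m + P.K) (cd : ContourData P j G) (V : GaugeField P j G) (y : Site P (j + 1)) :
    axializer cd V (emb y) = 1 := by
  simp only [axializer, Site.blockOf_emb hj, if_true]

/-- Off the centre of its block the axialiser is the block contour. [cite: Balaban1987RG1, p.265 (2.3) (bookkeeping)] -/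
theorem axializer_of_ne (cd : ContourData P j G) (V : GaugeField P j G) {y : Site P (j + 1)} {x : Site P j} (hxy : blockOf x = y)
    (hx : x ≠ emb y) : axializer cd V x = cd.holTo V y x := by
  simp only [axializer, hxy, hx, if_false]

/-! ## §2. Block contours of the representative are trivial: `AxialGauge`, `G = 0` -/

/-- **Every block contour of the block-axial representative is `1`**: `U(y, x) = 1` for `x ∈ B(y)`, `x ≠ y`, computed on `axialize cd V` (contour covariance
`U^u(y,x) = u(y)U(y,x)u(x)⁻¹` with `u(y) = 1`, `u(x) = U(y,x)`). [cite: Balaban1987RG1, p.265 («the axial gauge conditions G(V) = 0»)] -/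
theorem holTo_axialize (hj : j + 1 ≤ P.m + P.K) (cd : ContourData P j G) (V : GaugeField P j G) {y : Site P (j + 1)} {x : Site P j}
    (hxy : blockOf x = y) (hx : x ≠ emb y) : cd.holTo (axialize cd V) y x = 1 := by
  rw [axialize, cd.covariant, axializer_emb hj, axializer_of_ne cd V hxy hx, one_mul, mul_inv_cancel]

/-- The block-axial representative satisfies the tree's block axial gauge `Setup.AxialGauge`. [cite: Balaban1984PropagatorsI, (1.10) p.19] -/
theorem axialGauge_axialize (hj : j + 1 ≤ P.m + P.K) (cd : ContourData P j G) (V : GaugeField P j G) : AxialGauge cd (axialize cd V) :=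
  fun _ _ hxy hx => holTo_axialize hj cd V hxy hx

/-- **`G(Y, V^{(k)}) = 0`** — print's normalisation of the critical configuration: the gauge-fixing function (0.17) vanishes on the block-axial
representative, for every family `Y` of blocks (whence (2.5) «G(VV^{(k)}) = G(V′)»). [cite: Balaban1987RG1, (0.17) p.255, p.265 and (2.5) p.266] -/
theorem gaugeFixFn_axialize (hj : j + 1 ≤ P.m + P.K) (cd : ContourData P j G) (V : GaugeField P j G) (Y : Finset (Site P (j + 1))) :
    gaugeFixFn cd Y (axialize cd V) = 0 := by
  refine Finset.sum_eq_zero fun y _ => Finset.sum_eq_zero fun x hx => ?_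
  rw [Finset.mem_erase] at hx
  have hxy : blockOf x = y := by simpa [block] using hx.2
  rw [holTo_axialize hj cd V hxy hx.1, GaugeGroup.reTr_one, sub_self]

/-- A configuration already in the block axial gauge is its own representative (the axialiser is then `1` everywhere).
[cite: Balaban1984PropagatorsI, (1.10) p.19; Balaban1987RG1, p.265 (bookkeeping)] -/
theorem axialize_eq_self_of_axialGauge (hj : j + 1 ≤ P.m + P.K) (cd : ContourData P j G) {V : GaugeField P j G} (h : AxialGauge cd V) :
    axialize cd V = V := by
  have ha : axializer cd V = fun _ => 1 := by
    funext x
    by_cases hx : x = emb (blockOf x)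
    · rw [hx]; exact axializer_emb hj cd V _
    · rw [axializer_of_ne cd V rfl hx]; exact h (blockOf x) x rfl hx
  funext b
  simp only [axialize, gaugeAct, ha, one_mul, inv_one, mul_one]

/-! ## §3. Independence of the representative within the residual freedom, and uniqueness -/

/-- The axialiser of `V^w`, for `w` equal to `1` at every block centre, is the axialiser of `V` times `w⁻¹`.
[cite: Balaban1987RG1, p.265 (2.3) with (0.21) p.256 (bookkeeping)] -/
theorem axializer_gaugeAct_of_central (cd : ContourData P j G) (V : GaugeField P j G) {w : GaugeTransf P j G}
    (hw : ∀ y : Site P (j + 1), w (emb y) = 1) (x : Site P j) : axializer cd (gaugeAct w V) x = axializer cd V x * (w x)⁻¹ := by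
  by_cases hx : x = emb (blockOf x)
  · simp only [axializer, if_pos hx, one_mul]
    conv_lhs => rw [← inv_one, ← hw (blockOf x), ← hx]
  · simp only [axializer, if_neg hx, cd.covariant, hw, one_mul]

/-- **THE REPRESENTATIVE IS BLIND TO THE RESIDUAL FREEDOM**: for every gauge transformation `w` with `w = 1` at the block centres,
`axialize cd (V^w) = axialize cd V`.  (Two minimisers of (0.21) over one coarse field in one residual orbit of the next level have k-fold averages
`V`, `V^w` with exactly such a `w`; so the block-axial critical configuration does not depend on which minimiser is chosen, while the bare average does.)
[cite: Balaban1987RG1, p.265 (2.2)–(2.3), (0.21) p.256] -/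
theorem axialize_gaugeAct_of_central (cd : ContourData P j G) (V : GaugeField P j G) {w : GaugeTransf P j G}
    (hw : ∀ y : Site P (j + 1), w (emb y) = 1) : axialize cd (gaugeAct w V) = axialize cd V := by
  funext b
  simp only [axialize, gaugeAct, axializer_gaugeAct_of_central cd V hw]
  group

/-- **UNIQUENESS**: a block-axial configuration of the form `V^w` with `w` central IS the representative of `V` (print: «the exactly one critical point …
choosing the element of the orbit satisfying the axial gauge conditions»). [cite: Balaban1987RG1, p.265 (2.2)–(2.3)] -/
theorem eq_axialize_of_axialGauge_of_central (hj : j + 1 ≤ P.m + P.K) (cd : ContourData P j G) (V : GaugeField P j G) {w : GaugeTransf P j G}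
    (hw : ∀ y : Site P (j + 1), w (emb y) = 1) (h : AxialGauge cd (gaugeAct w V)) : gaugeAct w V = axialize cd V := by
  rw [← axialize_gaugeAct_of_central cd V hw, axialize_eq_self_of_axialGauge hj cd h]

/-! ## §4. Covariance under the block-constant lifts of coarse gauge transformations -/

/-- The axialiser of `V^{v∘blockOf}` is the conjugate `(v∘blockOf)·(axializer V)·(v∘blockOf)⁻¹`. [cite: Balaban1987RG1, (2.16) p.269 (bookkeeping)] -/
theorem axializer_gaugeAct_liftTransf (hj : j + 1 ≤ P.m + P.K) (cd : ContourData P j G) (V : GaugeField P j G) (v : GaugeTransf P (j + 1) G)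
    (x : Site P j) : axializer cd (gaugeAct (liftTransf v) V) x = liftTransf v x * axializer cd V x * (liftTransf v x)⁻¹ := by
  by_cases hx : x = emb (blockOf x)
  · simp only [axializer, if_pos hx, mul_one, mul_inv_cancel]
  · simp only [axializer, if_neg hx, cd.covariant, liftTransf, Site.blockOf_emb hj]

/-- **BLOCK-LIFT COVARIANCE OF THE REPRESENTATIVE**: `axialize cd (V^{v∘blockOf}) = (axialize cd V)^{v∘blockOf}` — the normalisation commutes with the
lifted coarse gauge transformations (the gauge covariance the record's (2.9) cut-off needs, [I] (2.16)). [cite: Balaban1987RG1, (2.16) p.269, p.265 (2.3)] -/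
theorem axialize_gaugeAct_liftTransf (hj : j + 1 ≤ P.m + P.K) (cd : ContourData P j G) (V : GaugeField P j G) (v : GaugeTransf P (j + 1) G) :
    axialize cd (gaugeAct (liftTransf v) V) = gaugeAct (liftTransf v) (axialize cd V) := by
  funext b
  simp only [axialize, gaugeAct, axializer_gaugeAct_liftTransf hj]
  group

/-! ## §5. (v2 APPEND) Measurability of the representative — the bookkeeping the record's measurability rows (`measChi`-type) need once the (2.9) cut-off is
centred at `axialize` (director-ym WORK ORDER RC-1); continuity is the same two lines over the product topology of `BlockAveragingExpMeanLogContinuous`, not imported here -/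

section Regularity

/-- Each value of the axialiser is a measurable function of the configuration as soon as the block contours are. [cite: Balaban1987RG1, (0.11) p.253 and p.265 (bookkeeping)] -/
theorem measurable_axializer_apply [MeasurableSpace G] (cd : ContourData P j G) (hhol : ∀ (y : Site P (j + 1)) (x : Site P j), Measurable fun V => cd.holTo V y x)
    (x : Site P j) : Measurable fun V => axializer cd V x := by
  by_cases hx : x = emb (blockOf x)
  · simp only [axializer, if_pos hx]
    exact measurable_const
  · simp only [axializer, if_neg hx]
    exact hhol _ _

/-- **The block-axial representative is a MEASURABLE function of the configuration** (bondwise products of measurable factors), as soon as the block contours are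
measurable (for the record's contour datum: `Node00.measurable_holTo_contourOfRecord`). [cite: Balaban1987RG1, p.265 (2.3) (bookkeeping)] -/
theorem measurable_axialize [MeasurableSpace G] [MeasurableMul₂ G] [MeasurableInv G] (cd : ContourData P j G)
    (hhol : ∀ (y : Site P (j + 1)) (x : Site P j), Measurable fun V => cd.holTo V y x) : Measurable (axialize cd) := by
  refine measurable_pi_lambda _ fun b => ?_
  have hb : Measurable fun V : GaugeField P j G => V b := measurable_pi_apply b
  show Measurable fun V : GaugeField P j G => axializer cd V b.src * V b * (axializer cd V b.tgt)⁻¹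
  exact ((measurable_axializer_apply cd hhol b.src).mul hb).mul (measurable_axializer_apply cd hhol b.tgt).inv

end Regularity

end Literature.MathematicalPhysics.QuantumFieldTheory.Balaban1983to89.BlockAxialRepresentative
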